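import Summits.HubbardSuperconductivity.HubbardSuperconductivity.Theorems.AnisotropyChordTransferFibre3Schur
import Summits.HubbardSuperconductivity.HubbardSuperconductivity.Theorems.AnisotropyChordTransferFibre3Certificate
import Summits.HubbardSuperconductivity.HubbardSuperconductivity.Theorems.AnisotropyChordTransferFibre3PhiAntitone

/-!
# Route `AnisotropyChord` / H0 rotor rung: PORT N30-A — invertibility of `𝒩(T)` for all `T ≤ T*` from ONE positivity check

Memo ROTOR-THEORY-20 §279(d)–(f) (theory seat `hubbard-h0-rotor-theory-1`, cycle 20): the shell matrix
`Q̃(T) = (ΔW)⁻¹ − R(T)`, `R(T) = G_SS − G_SD G_DD⁻¹ G_DS` (Schur complement of the free resolvent compressed to `D ⊕ S`),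
is non-increasing in `T`, because `R(T)[y] = min_x G_T[(x,y)]` (completing the square, `schur_complete`) and the kernel
`G_T` is non-decreasing in `T` (`1/den` increases).  Hence `Re⟨y, Q̃(T) y⟩ ≥ Re⟨y, Q̃(T*) y⟩` for `T ≤ T*` (`re_Qtilde_mono`) and
**`nInvertibleBelow_of_posDef`**: `Q̃(T*) ≻ 0` (one finite-dimensional check, or LEMMA L2/κ₀ at the single point `T*`) gives
`NInvertibleBelow L Δ T*` (`L ≥ 4`, `T* < 2ε₁`).  With `…Fibre3Certificate` and `…Fibre3PhiAntitone` the ∀L GM₃ certificate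
`gm3Fibre_of_certificate` now takes: `Q̃(T*) ≻ 0`, `T* < Φ(T*)`, and a `K = 0` admissible state with Rayleigh quotient `≤ T*`.
Prover seat `hubbard-h0-rotor-p1` g21; helper for stmt-HubbardSuperconductivity-19089 (`--supports`).
-/

set_option linter.dupNamespace false
set_option autoImplicit false

noncomputable section

open scoped BigOperators
open Complex Matrix

namespace Summit.HubbardSuperconductivity.HubbardSuperconductivity.Theorems.AnisotropyChord.Transfer.Fibre3

section Abstract

variable {m n : Type} [Fintype m] [Fintype n] [DecidableEq m] [DecidableEq n]

omit [DecidableEq m] [DecidableEq n] in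
/-- `star (A u) · v = star u · (Aᴴ v)`. [folklore] -/
theorem star_mulVec_dotProduct (A : Matrix m n ℂ) (u : n → ℂ) (v : m → ℂ) :
    star (A *ᵥ u) ⬝ᵥ v = star u ⬝ᵥ (Aᴴ *ᵥ v) := by
  rw [Matrix.star_mulVec, ← Matrix.dotProduct_mulVec]

omit [DecidableEq n] in
/-- **completing the square** for a Hermitian block matrix with invertible corner:
`⟨(x,y), [[P,Bᴴ],[B,C]](x,y)⟩ = ⟨w, P w⟩ + ⟨y, (C − B P⁻¹ Bᴴ) y⟩`, `w = x + P⁻¹Bᴴy`. [folklore] -/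
theorem schur_complete (P : Matrix m m ℂ) (BH : Matrix m n ℂ) (B : Matrix n m ℂ) (C : Matrix n n ℂ)
    (hP : Pᴴ = P) (hB : BHᴴ = B) (hdet : IsUnit P.det) (x : m → ℂ) (y : n → ℂ) :
    star (Sum.elim x y) ⬝ᵥ (Matrix.fromBlocks P BH B C) *ᵥ (Sum.elim x y)
      = star (x + P⁻¹ *ᵥ (BH *ᵥ y)) ⬝ᵥ P *ᵥ (x + P⁻¹ *ᵥ (BH *ᵥ y))
        + star y ⬝ᵥ (C - B * P⁻¹ * BH) *ᵥ y := by
  have hPinv : (P⁻¹)ᴴ = P⁻¹ := by rw [Matrix.conjTranspose_nonsing_inv, hP]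
  have h1 : P *ᵥ (P⁻¹ *ᵥ (BH *ᵥ y)) = BH *ᵥ y := by
    rw [Matrix.mulVec_mulVec, Matrix.mul_nonsing_inv _ hdet, Matrix.one_mulVec]
  have h2 : ∀ v : m → ℂ, star (P⁻¹ *ᵥ (BH *ᵥ y)) ⬝ᵥ v = star y ⬝ᵥ (B *ᵥ (P⁻¹ *ᵥ v)) := by
    intro v
    rw [star_mulVec_dotProduct, hPinv, star_mulVec_dotProduct, hB]
  have hstar : star (Sum.elim x y) = Sum.elim (star x) (star y) := by
    funext i; cases i <;> rfl
  have h3 : P⁻¹ *ᵥ (P *ᵥ x) = x := by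
    rw [Matrix.mulVec_mulVec, Matrix.nonsing_inv_mul _ hdet, Matrix.one_mulVec]
  have h4 : (C - B * P⁻¹ * BH) *ᵥ y = C *ᵥ y - B *ᵥ (P⁻¹ *ᵥ (BH *ᵥ y)) := by
    rw [Matrix.sub_mulVec, Matrix.mulVec_mulVec, Matrix.mulVec_mulVec]
  rw [hstar, Matrix.fromBlocks_mulVec, Sum.elim_comp_inl, Sum.elim_comp_inr, sumElim_dotProduct_sumElim]
  rw [star_add, add_dotProduct, Matrix.mulVec_add, h1, h2, Matrix.mulVec_add P⁻¹, h3, Matrix.mulVec_add B, h4]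
  simp only [dotProduct_add, dotProduct_sub]
  ring

end Abstract

variable (L : ℕ) [NeZero L]

/-- `G_SS`. [folklore] -/
def GSS (T : ℝ) : Matrix (Ssub L) (Ssub L) ℂ := fun s s' => Gentry L T s.1 s'.1
/-- the free resolvent compressed to `D ⊕ S`. [folklore] -/
def GDS (T : ℝ) : Matrix (DS L) (DS L) ℂ := fun i j => Gentry L T (cfgOf L i) (cfgOf L j)
/-- the Schur complement `R(T) = G_SS − B P⁻¹ Bᴴ`. [folklore] -/
def Rmat (T : ℝ) : Matrix (Ssub L) (Ssub L) ℂ := GSS L T - Bmat L T * (Pmat L T)⁻¹ * BHmat L T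
/-- the contact diagonal `(ΔW)⁻¹`. [folklore] -/
def diagW (Δ : ℝ) : Matrix (Ssub L) (Ssub L) ℂ :=
  Matrix.diagonal fun s => (((1 / (Δ * (Wcount L s.1 : ℝ))) : ℝ) : ℂ)

/-- [folklore] -/
theorem GDS_eq_fromBlocks (T : ℝ) : GDS L T = Matrix.fromBlocks (Pmat L T) (BHmat L T) (Bmat L T) (GSS L T) := by
  ext i j
  rcases i with d | s <;> rcases j with d' | s' <;> rfl

/-- `Q̃ = (ΔW)⁻¹ − R`. [folklore] -/
theorem Qtilde_eq (T Δ : ℝ) : Qtilde L T Δ = diagW L Δ - Rmat L T := by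
  unfold Qtilde Rmat
  have hC : Cmat L T Δ = GSS L T - diagW L Δ := by
    ext s s'
    unfold Cmat GSS diagW
    rw [Matrix.sub_apply, Matrix.diagonal_apply]
  rw [hC]
  abel

/-- `P = G_DD` is a Hermitian block. [folklore] -/
theorem Pmat_isHermitian (T : ℝ) : (Pmat L T).IsHermitian := by
  unfold Matrix.IsHermitian
  ext d d'; rw [conjTranspose_apply, star_def]; unfold Pmat; rw [conj_Gentry]

/-- [folklore] -/
theorem BHmat_conjTranspose (T : ℝ) : (BHmat L T)ᴴ = Bmat L T := by
  ext s d; rw [conjTranspose_apply, star_def]; unfold BHmat Bmat; rw [conj_Gentry]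

/-- **weighted-kernel quadratic form** on `D ⊕ S`: if `M_{ij} = V⁻² Σ_k w_k pw_k(c_i) conj(pw_k(c_j))` then
`⟨y, M y⟩ = V⁻² Σ_k w_k |Z_k(y)|²`. [folklore] -/
theorem kernel_form (w : Tor L × Tor L → ℝ) (M : Matrix (DS L) (DS L) ℂ)
    (hM : ∀ i j, M i j = (1 / ((L : ℂ) ^ 2) ^ 2) * ∑ k : Tor L × Tor L,
      (w k : ℂ) * (pw L k.1 k.2 (cfgOf L i) * (starRingEnd ℂ) (pw L k.1 k.2 (cfgOf L j)))) (y : DS L → ℂ) :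
    star y ⬝ᵥ M *ᵥ y
      = (1 / ((L : ℂ) ^ 2) ^ 2) * ∑ k : Tor L × Tor L, (w k : ℂ) * ((starRingEnd ℂ) (Zk L y k) * Zk L y k) := by
  have hmv : ∀ i : DS L, (M *ᵥ y) i
      = (1 / ((L : ℂ) ^ 2) ^ 2) * ∑ k : Tor L × Tor L, (w k : ℂ) * (pw L k.1 k.2 (cfgOf L i) * Zk L y k) := by
    intro i
    simp only [Matrix.mulVec, dotProduct]
    simp_rw [hM]
    unfold Zk
    calc ∑ j : DS L, ((1 / ((L : ℂ) ^ 2) ^ 2) * ∑ k : Tor L × Tor L,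
            (w k : ℂ) * (pw L k.1 k.2 (cfgOf L i) * (starRingEnd ℂ) (pw L k.1 k.2 (cfgOf L j)))) * y j
        = ∑ j : DS L, ∑ k : Tor L × Tor L, (1 / ((L : ℂ) ^ 2) ^ 2) *
            ((w k : ℂ) * (pw L k.1 k.2 (cfgOf L i) * ((starRingEnd ℂ) (pw L k.1 k.2 (cfgOf L j)) * y j))) := by
          refine Finset.sum_congr rfl fun j _ => ?_
          rw [Finset.mul_sum, Finset.sum_mul]
          refine Finset.sum_congr rfl fun k _ => ?_
          ring
      _ = ∑ k : Tor L × Tor L, ∑ j : DS L, (1 / ((L : ℂ) ^ 2) ^ 2) *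
            ((w k : ℂ) * (pw L k.1 k.2 (cfgOf L i) * ((starRingEnd ℂ) (pw L k.1 k.2 (cfgOf L j)) * y j))) :=
          Finset.sum_comm
      _ = (1 / ((L : ℂ) ^ 2) ^ 2) * ∑ k : Tor L × Tor L, (w k : ℂ) * (pw L k.1 k.2 (cfgOf L i)
            * ∑ j : DS L, (starRingEnd ℂ) (pw L k.1 k.2 (cfgOf L j)) * y j) := by
          rw [Finset.mul_sum]
          refine Finset.sum_congr rfl fun k _ => ?_
          rw [Finset.mul_sum, Finset.mul_sum, Finset.mul_sum]
  simp only [dotProduct, Pi.star_apply, star_def]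
  simp_rw [hmv]
  have hconj : ∀ k : Tor L × Tor L,
      (starRingEnd ℂ) (Zk L y k) = ∑ i : DS L, (starRingEnd ℂ) (y i) * pw L k.1 k.2 (cfgOf L i) := by
    intro k; unfold Zk; rw [map_sum]
    refine Finset.sum_congr rfl fun i _ => ?_
    rw [map_mul, Complex.conj_conj]; ring
  calc ∑ i : DS L, (starRingEnd ℂ) (y i) * ((1 / ((L : ℂ) ^ 2) ^ 2) * ∑ k : Tor L × Tor L,
          (w k : ℂ) * (pw L k.1 k.2 (cfgOf L i) * Zk L y k))
      = ∑ i : DS L, ∑ k : Tor L × Tor L, (1 / ((L : ℂ) ^ 2) ^ 2) *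
          ((w k : ℂ) * (((starRingEnd ℂ) (y i) * pw L k.1 k.2 (cfgOf L i)) * Zk L y k)) := by
        refine Finset.sum_congr rfl fun i _ => ?_
        rw [Finset.mul_sum, Finset.mul_sum]
        refine Finset.sum_congr rfl fun k _ => ?_
        ring
    _ = ∑ k : Tor L × Tor L, ∑ i : DS L, (1 / ((L : ℂ) ^ 2) ^ 2) *
          ((w k : ℂ) * (((starRingEnd ℂ) (y i) * pw L k.1 k.2 (cfgOf L i)) * Zk L y k)) := Finset.sum_comm
    _ = (1 / ((L : ℂ) ^ 2) ^ 2) * ∑ k : Tor L × Tor L, (w k : ℂ) * ((starRingEnd ℂ) (Zk L y k) * Zk L y k) := by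
        rw [Finset.mul_sum]
        refine Finset.sum_congr rfl fun k _ => ?_
        rw [hconj k, Finset.sum_mul, Finset.mul_sum, Finset.mul_sum]

/-- `Re⟨y, G_DS(T) y⟩ = V⁻² Σ_k w¹_k(T) |Z_k(y)|²`. [folklore] -/
theorem re_GDS_form (T : ℝ) (y : DS L → ℂ) :
    (star y ⬝ᵥ GDS L T *ᵥ y).re = (1 / ((L : ℝ) ^ 2) ^ 2) * ∑ k : Tor L × Tor L, w1 L T k * ‖Zk L y k‖ ^ 2 := by
  rw [kernel_form L (w1 L T) (GDS L T) (fun i j => by unfold GDS; rw [Gentry_eq_w1]) y]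
  have hV : (1 / ((L : ℂ) ^ 2) ^ 2) = (((1 / ((L : ℝ) ^ 2) ^ 2 : ℝ)) : ℂ) := by push_cast; ring
  rw [hV, Complex.re_ofReal_mul, Complex.re_sum]
  congr 1
  refine Finset.sum_congr rfl fun k _ => ?_
  rw [Complex.re_ofReal_mul, Complex.conj_mul', show ((‖Zk L y k‖ : ℂ) ^ 2) = (((‖Zk L y k‖ ^ 2 : ℝ)) : ℂ) by
    push_cast; ring, Complex.ofReal_re]

/-- **kernel monotonicity:** `Re⟨y, G_DS(T) y⟩ ≤ Re⟨y, G_DS(T*) y⟩` for `T ≤ T* < 2ε₁` (`L ≥ 4`). [folklore] -/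
theorem re_GDS_mono (hL : 4 ≤ L) {T Ts : ℝ} (hT : T ≤ Ts) (hTs : Ts < 2 * eps1 L) (y : DS L → ℂ) :
    (star y ⬝ᵥ GDS L T *ᵥ y).re ≤ (star y ⬝ᵥ GDS L Ts *ᵥ y).re := by
  rw [re_GDS_form, re_GDS_form]
  apply mul_le_mul_of_nonneg_left _ (by positivity)
  apply Finset.sum_le_sum
  intro k _
  apply mul_le_mul_of_nonneg_right _ (sq_nonneg _)
  unfold w1
  split_ifs with hk
  · exact le_rfl
  · have hk' : IsPoleK1 L k.1 k.2 = false := by simpa using hk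
    have h1 := den_pos L hL hTs hk'
    apply one_div_le_one_div_of_le h1
    rw [den_eq, den_eq]; linarith

/-- `P(T) ≥ 0`. [folklore] -/
theorem re_P_nonneg (hL : 4 ≤ L) {T : ℝ} (hT : T < 2 * eps1 L) (x : Dsub L → ℂ) :
    0 ≤ (star x ⬝ᵥ Pmat L T *ᵥ x).re := by
  rw [P_form]
  have hV : (1 / ((L : ℂ) ^ 2) ^ 2) = (((1 / ((L : ℝ) ^ 2) ^ 2 : ℝ)) : ℂ) := by push_cast; ring
  rw [hV, Complex.re_ofReal_mul]
  apply mul_nonneg (by positivity)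
  rw [Complex.re_sum]
  apply Finset.sum_nonneg
  intro k _
  rw [Complex.re_ofReal_mul, Complex.conj_mul', show ((‖ZD L x k‖ : ℂ) ^ 2) = (((‖ZD L x k‖ ^ 2 : ℝ)) : ℂ) by
    push_cast; ring, Complex.ofReal_re]
  apply mul_nonneg _ (sq_nonneg _)
  unfold w1; split_ifs with hk
  · exact le_rfl
  · have hk' : IsPoleK1 L k.1 k.2 = false := by simpa using hk
    exact le_of_lt (one_div_pos.mpr (den_pos L hL hT hk'))

/-- the Schur complement as a constrained value of the full form: `⟨(x,y), G_DS (x,y)⟩ = ⟨w, P w⟩ + ⟨y, R y⟩`. [folklore] -/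
theorem GDS_form_split (hL : 4 ≤ L) {T : ℝ} (hT : T < 2 * eps1 L) (x : Dsub L → ℂ) (y : Ssub L → ℂ) :
    star (Sum.elim x y) ⬝ᵥ GDS L T *ᵥ (Sum.elim x y)
      = star (x + (Pmat L T)⁻¹ *ᵥ (BHmat L T *ᵥ y)) ⬝ᵥ Pmat L T *ᵥ (x + (Pmat L T)⁻¹ *ᵥ (BHmat L T *ᵥ y))
        + star y ⬝ᵥ Rmat L T *ᵥ y := by
  rw [GDS_eq_fromBlocks]
  unfold Rmat GSS
  exact schur_complete _ _ _ _ (Pmat_isHermitian L T).eq (BHmat_conjTranspose L T)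
    (isUnit_iff_ne_zero.mpr (det_P_ne_zero L hL hT)) x y

/-- **the Schur complement is non-decreasing in `T`:** `Re⟨y, R(T) y⟩ ≤ Re⟨y, R(T*) y⟩` for `T ≤ T* < 2ε₁`. [folklore] -/
theorem re_R_mono (hL : 4 ≤ L) {T Ts : ℝ} (hT : T ≤ Ts) (hTs : Ts < 2 * eps1 L) (y : Ssub L → ℂ) :
    (star y ⬝ᵥ Rmat L T *ᵥ y).re ≤ (star y ⬝ᵥ Rmat L Ts *ᵥ y).re := by
  have hT' : T < 2 * eps1 L := lt_of_le_of_lt hT hTs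
  set xs : Dsub L → ℂ := -((Pmat L Ts)⁻¹ *ᵥ (BHmat L Ts *ᵥ y)) with hxs
  have h1 := GDS_form_split L hL hT' xs y
  have h2 := GDS_form_split L hL hTs xs y
  have hw : xs + (Pmat L Ts)⁻¹ *ᵥ (BHmat L Ts *ᵥ y) = 0 := by rw [hxs]; exact neg_add_cancel _
  rw [hw, Matrix.mulVec_zero, dotProduct_zero, zero_add] at h2
  have hmono := re_GDS_mono L hL hT hTs (Sum.elim xs y)
  have hP := re_P_nonneg L hL hT' (xs + (Pmat L T)⁻¹ *ᵥ (BHmat L T *ᵥ y))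
  rw [h1, Complex.add_re] at hmono
  rw [h2] at hmono
  linarith

/-- **`Q̃` is non-increasing in `T`:** `Re⟨y, Q̃(T*) y⟩ ≤ Re⟨y, Q̃(T) y⟩` for `T ≤ T* < 2ε₁`. [folklore] -/
theorem re_Qtilde_mono (hL : 4 ≤ L) {T Ts : ℝ} (hT : T ≤ Ts) (hTs : Ts < 2 * eps1 L) (Δ : ℝ) (y : Ssub L → ℂ) :
    (star y ⬝ᵥ Qtilde L Ts Δ *ᵥ y).re ≤ (star y ⬝ᵥ Qtilde L T Δ *ᵥ y).re := by
  rw [Qtilde_eq, Qtilde_eq, Matrix.sub_mulVec, Matrix.sub_mulVec, dotProduct_sub, dotProduct_sub,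
    Complex.sub_re, Complex.sub_re]
  have := re_R_mono L hL hT hTs y
  linarith

/-- **`NInvertibleBelow` from ONE positivity check:** if `Q̃(T*) ≻ 0` then `𝒩(T)` is invertible for every `T ≤ T*`
(`L ≥ 4`, `T* < 2ε₁`). [folklore] -/
theorem nInvertibleBelow_of_posDef (hL : 4 ≤ L) (Δ Tstar : ℝ) (hTs : Tstar < 2 * eps1 L)
    (hQ : ∀ y : Ssub L → ℂ, y ≠ 0 → 0 < (star y ⬝ᵥ Qtilde L Tstar Δ *ᵥ y).re) : NInvertibleBelow L Δ Tstar := by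
  apply nInvertibleBelow_of_shell L hL Δ Tstar hTs
  intro T hT hdet
  obtain ⟨y, hy, hQy⟩ := Matrix.exists_mulVec_eq_zero_iff.mpr hdet
  have h0 : (star y ⬝ᵥ Qtilde L T Δ *ᵥ y).re = 0 := by rw [hQy, dotProduct_zero, Complex.zero_re]
  have := re_Qtilde_mono L hL hT hTs Δ y
  have := hQ y hy
  linarith

/-- **the GM₃ certificate with all analytic inputs discharged** (`L ≥ 4`, `Δ ≠ 0`, `T* < 2ε₁`): the shell positivity
`Q̃(T*) ≻ 0`, the Krein inequality `T* < Φ(T*)` and a `K = 0` admissible state with Rayleigh quotient `≤ T*` imply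
`GM3Fibre L Δ`. [folklore] -/
theorem gm3Fibre_of_checks (hL : 4 ≤ L) {Δ : ℝ} (hΔ : Δ ≠ 0) (Tstar : ℝ) (hTs : Tstar < 2 * eps1 L)
    (hQ : ∀ y : Ssub L → ℂ, y ≠ 0 → 0 < (star y ⬝ᵥ Qtilde L Tstar Δ *ᵥ y).re)
    (hPhi : Tstar < Phi L Tstar Δ) (hG : ∃ G : Cfg L → ℂ, Admissible L 0 G ∧ RQ L 0 Δ G ≤ Tstar) :
    GM3Fibre L Δ :=
  gm3Fibre_of_certificate L hL hΔ Tstar hTs (phiAntitone_holds L hL Δ)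
    (nInvertibleBelow_of_posDef L hL Δ Tstar hTs hQ) hPhi hG

end Summit.HubbardSuperconductivity.HubbardSuperconductivity.Theorems.AnisotropyChord.Transfer.Fibre3

end
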